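import Summits.CriticalPhenomena.PercolationContinuityZ3.Theorems.PercNearOneGluingNoHeavyLowerTailSahiTangentScaling

/-!
# `NoHeavyLowerTail` (crux stmt-CriticalPhenomena-4575), Sahi programme: the PAIR COEFFICIENTS `ψ_{i,j}(s)` of the coin expansion of
# Sahi's `E_n` (companion `…SahiTangentPairExpansion`): definitions, nonnegativity, and the two recursion identities (I1), (I2)

Support file (Sahi cell, seat `prim-sahi-p1`, generation 51; `--supports stmt-CriticalPhenomena-4575`).  Bookkeeping definitions (`ascR`,
`pairCoeff`, `cT`, `cF`, `cbf`, `pairTerm`, `pairSum`) and pure proofs; no `sorry`, standard axioms.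

CONTENT.  For the coin expansion (proved in `…SahiTangentPairExpansion`)
`E_n^{B_s⊗μ}(ε ? g¹ : g⁰) = Σ_{π} Σ_{Ψ ⊆ blocks(π)} ψ_{|Ψ|,|π|−|Ψ|}(s) · Π_{B∈Ψ} (E(g¹|_B) − E(g⁰|_B)) · Π_{B∉Ψ} E(g⁰|_B)`
this file supplies:
* §1 the ascending products `ascR a j = a(a+1)⋯(a+j−1)` (shift and Pascal rules) and the coefficients
  `ψ_{i,j}(s)` = `pairCoeff s i j`: `ψ_{0,j} = [j=1]`, `ψ_{1,j} = [j=0]·s`, `ψ_{i+2,j} = φ_{i+2}(s)·(i+1)(i+2)⋯(i+j)` with `φ` = `scalingCoeff`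
  of `…SahiTangentScaling`; **all `ψ_{i,j}(s) ≥ 0` for `0 ≤ s ≤ 1`** (`pairCoeff_nonneg`); and the identities that close the Lieb–Sahi
  recursion, for `(i,j) ≠ (0,0)`:
  (I1) `ψ_{i+1,j} − i·ψ_{i,j} − j·ψ_{i+1,j−1} = −s·ψ_{i,j}`,  (I2) `ψ_{i,j+1} − ψ_{i+1,j} − j·ψ_{i,j} + j·ψ_{i+1,j−1} = −(1−s)·ψ_{i,j}`;
* §2 colourings `χ : blocks → Bool` of an ordered finpartition (`cT`/`cF` = number of `true`/`false` blocks, their behaviour under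
  `Fin.cons` and under recolouring one block), the coloured block factor `cbf` (`Δ_B = E(g¹|_B) − E(g⁰|_B)` on `true` blocks,
  `E(g⁰|_B)` on `false` blocks, block functionals `blockE` of `…SahiTangentScaling`), the summand `pairTerm` and the sum `pairSum`;
* §3 the block of `0` in `c.extendMiddle k₀` expanded by the Lieb–Sahi recursion (`blockE_extendMiddle_self_expand`).
Series-level mechanism: [Sahi2008, proof of Thm. 1, eq. (12)] `(1 − G¹)^s(1 − G⁰)^{1−s}` and Sahi's two binomial sign computations.
Nothing conjectural is asserted. [this work]
-/

namespace Summit.CriticalPhenomena.PercolationContinuityZ3.Theorems.SahiTangent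

open Finset Function Literature.Combinatorics.Sahi2008
open scoped BigOperators

noncomputable section

variable {α : Type*} [Fintype α]

/-! ### §1 Ascending products and the pair coefficients `ψ_{i,j}(s)` -/

/-- The ascending product `a(a+1)⋯(a+j−1)` as a real number (`ascR a 0 = 1`). [folklore] -/
def ascR (a : ℕ) : ℕ → ℝ
  | 0 => 1
  | j + 1 => ascR a j * ((a : ℝ) + j)

/-- `ascR a 0 = 1`. [folklore] -/
theorem ascR_zero (a : ℕ) : ascR a 0 = 1 := rfl

/-- `ascR a (j+1) = ascR a j · (a + j)`. [folklore] -/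
theorem ascR_succ (a j : ℕ) : ascR a (j + 1) = ascR a j * ((a : ℝ) + j) := rfl

/-- Shift: `a·(a+1)⋯(a+j) = a · [(a+1)⋯(a+j)]`. [folklore] -/
theorem ascR_succ_eq_mul (a : ℕ) : ∀ j : ℕ, ascR a (j + 1) = (a : ℝ) * ascR (a + 1) j
  | 0 => by rw [ascR_succ, ascR_zero, ascR_zero]; push_cast; ring
  | j + 1 => by rw [ascR_succ, ascR_succ_eq_mul a j, ascR_succ]; push_cast; ring

/-- Pascal rule for ascending products: `(a+1)^{(j+1)} = (j+1)·(a+1)^{(j)} + a^{(j+1)}`. [folklore] -/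
theorem ascR_pascal (a j : ℕ) : ascR (a + 1) (j + 1) = ((j : ℝ) + 1) * ascR (a + 1) j + ascR a (j + 1) := by
  rw [ascR_succ, ascR_succ_eq_mul]; push_cast; ring

/-- `ascR a j ≥ 0`. [folklore] -/
theorem ascR_nonneg (a : ℕ) : ∀ j : ℕ, 0 ≤ ascR a j
  | 0 => by rw [ascR_zero]; exact zero_le_one
  | j + 1 => by rw [ascR_succ]; exact mul_nonneg (ascR_nonneg a j) (by positivity)

/-- The pair coefficients `ψ_{i,j}(s)`: `ψ_{0,j} = [j = 1]`, `ψ_{1,j} = [j = 0]·s`, `ψ_{i+2,j} = φ_{i+2}(s)·(i+1)(i+2)⋯(i+j)`. [this work] -/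
def pairCoeff (s : ℝ) : ℕ → ℕ → ℝ
  | 0, j => if j = 1 then 1 else 0
  | 1, j => if j = 0 then s else 0
  | i + 2, j => scalingCoeff s (i + 2) * ascR (i + 1) j

/-- `ψ_{0,j} = [j = 1]`. [this work] -/
theorem pairCoeff_zero_left (s : ℝ) (j : ℕ) : pairCoeff s 0 j = if j = 1 then 1 else 0 := rfl

/-- `ψ_{1,j} = [j = 0]·s`. [this work] -/
theorem pairCoeff_one_left (s : ℝ) (j : ℕ) : pairCoeff s 1 j = if j = 0 then s else 0 := rfl

/-- `ψ_{i+2,j} = φ_{i+2}(s)·(i+1)⋯(i+j)`. [this work] -/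
theorem pairCoeff_add_two (s : ℝ) (i j : ℕ) : pairCoeff s (i + 2) j = scalingCoeff s (i + 2) * ascR (i + 1) j := rfl

/-- All pair coefficients are nonnegative for `0 ≤ s ≤ 1`. [this work] -/
theorem pairCoeff_nonneg {s : ℝ} (hs0 : 0 ≤ s) (hs1 : s ≤ 1) : ∀ i j : ℕ, 0 ≤ pairCoeff s i j
  | 0, j => by rw [pairCoeff_zero_left]; split_ifs <;> norm_num
  | 1, j => by rw [pairCoeff_one_left]; split_ifs; exacts [hs0, le_rfl]
  | i + 2, j => by rw [pairCoeff_add_two]; exact mul_nonneg (scalingCoeff_succ_nonneg hs0 hs1 (i + 1)) (ascR_nonneg _ j)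

/-- The key step for `i ≥ 2`: `ψ_{a+3,j} − j·ψ_{a+3,j−1} = (a + 2 − s)·ψ_{a+2,j}`. [this work] -/
theorem pairCoeff_step (s : ℝ) (a : ℕ) : ∀ j : ℕ,
    pairCoeff s (a + 3) j - (j : ℝ) * pairCoeff s (a + 3) (j - 1) = ((a : ℝ) + 2 - s) * pairCoeff s (a + 2) j
  | 0 => by
    rw [show a + 3 = (a + 1) + 2 from rfl, pairCoeff_add_two, pairCoeff_add_two, ascR_zero, ascR_zero,
      show a + 1 + 2 = (a + 2) + 1 from rfl, scalingCoeff_succ]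
    push_cast; ring
  | j + 1 => by
    rw [show a + 3 = (a + 1) + 2 from rfl, pairCoeff_add_two, pairCoeff_add_two, Nat.add_sub_cancel, pairCoeff_add_two,
      show a + 1 + 1 = a + 2 from rfl, ascR_pascal, show a + 1 + 2 = (a + 2) + 1 from rfl, scalingCoeff_succ]
    push_cast; ring

/-- **(I1)** `ψ_{i+1,j} − i·ψ_{i,j} − j·ψ_{i+1,j−1} = −s·ψ_{i,j}` for `(i,j) ≠ (0,0)`. [this work] -/
theorem pairCoeff_I1 (s : ℝ) : ∀ i j : ℕ, ¬(i = 0 ∧ j = 0) →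
    pairCoeff s (i + 1) j - (i : ℝ) * pairCoeff s i j - (j : ℝ) * pairCoeff s (i + 1) (j - 1) = -s * pairCoeff s i j
  | 0, 0, h => (h ⟨rfl, rfl⟩).elim
  | 0, 1, _ => by simp [pairCoeff_one_left, pairCoeff_zero_left]
  | 0, j + 2, _ => by
    have e1 : pairCoeff s (0 + 1) (j + 2) = 0 := by rw [pairCoeff_one_left, if_neg (by omega)]
    have e2 : pairCoeff s 0 (j + 2) = 0 := by rw [pairCoeff_zero_left, if_neg (by omega)]
    have e3 : pairCoeff s (0 + 1) (j + 2 - 1) = 0 := by rw [pairCoeff_one_left, if_neg (by omega)]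
    rw [e1, e2, e3]
    ring
  | 1, 0, _ => by
    rw [show (1 : ℕ) + 1 = 0 + 2 from rfl, pairCoeff_add_two, ascR_zero, pairCoeff_one_left, if_pos rfl, scalingCoeff_two]
    push_cast; ring
  | 1, j + 1, _ => by
    rw [show (1 : ℕ) + 1 = 0 + 2 from rfl, pairCoeff_add_two, pairCoeff_add_two, Nat.add_sub_cancel, pairCoeff_one_left,
      if_neg (by omega), ascR_succ]
    push_cast; ring
  | a + 2, j, _ => by
    have h := pairCoeff_step s a j
    rw [show a + 2 + 1 = a + 3 from rfl]
    push_cast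
    linear_combination h

/-- **(I2)** `ψ_{i,j+1} − ψ_{i+1,j} − j·ψ_{i,j} + j·ψ_{i+1,j−1} = −(1−s)·ψ_{i,j}` for `(i,j) ≠ (0,0)`. [this work] -/
theorem pairCoeff_I2 (s : ℝ) : ∀ i j : ℕ, ¬(i = 0 ∧ j = 0) →
    pairCoeff s i (j + 1) - pairCoeff s (i + 1) j - (j : ℝ) * pairCoeff s i j + (j : ℝ) * pairCoeff s (i + 1) (j - 1) =
      -(1 - s) * pairCoeff s i j
  | 0, 0, h => (h ⟨rfl, rfl⟩).elim
  | 0, 1, _ => by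
    have e1 : pairCoeff s 0 (1 + 1) = 0 := by rw [pairCoeff_zero_left, if_neg (by omega)]
    have e2 : pairCoeff s (0 + 1) 1 = 0 := by rw [pairCoeff_one_left, if_neg (by omega)]
    have e3 : pairCoeff s 0 1 = 1 := by rw [pairCoeff_zero_left, if_pos rfl]
    have e4 : pairCoeff s (0 + 1) (1 - 1) = s := by rw [pairCoeff_one_left, if_pos rfl]
    rw [e1, e2, e3, e4]
    push_cast; ring
  | 0, j + 2, _ => by
    have e1 : pairCoeff s 0 (j + 2 + 1) = 0 := by rw [pairCoeff_zero_left, if_neg (by omega)]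
    have e2 : pairCoeff s (0 + 1) (j + 2) = 0 := by rw [pairCoeff_one_left, if_neg (by omega)]
    have e3 : pairCoeff s 0 (j + 2) = 0 := by rw [pairCoeff_zero_left, if_neg (by omega)]
    have e4 : pairCoeff s (0 + 1) (j + 2 - 1) = 0 := by rw [pairCoeff_one_left, if_neg (by omega)]
    rw [e1, e2, e3, e4]
    ring
  | 1, 0, _ => by
    rw [show (1 : ℕ) + 1 = 0 + 2 from rfl, pairCoeff_add_two, ascR_zero, pairCoeff_one_left, pairCoeff_one_left, if_neg (by omega),
      if_pos rfl, scalingCoeff_two]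
    push_cast; ring
  | 1, j + 1, _ => by
    rw [show (1 : ℕ) + 1 = 0 + 2 from rfl, pairCoeff_add_two, pairCoeff_add_two, Nat.add_sub_cancel, pairCoeff_one_left,
      pairCoeff_one_left, if_neg (by omega), if_neg (by omega), ascR_succ]
    push_cast; ring
  | a + 2, j, _ => by
    have h := pairCoeff_step s a j
    have e : pairCoeff s (a + 2) (j + 1) = ((a : ℝ) + 1 + j) * pairCoeff s (a + 2) j := by
      rw [pairCoeff_add_two, pairCoeff_add_two, ascR_succ]; push_cast; ring
    rw [show a + 2 + 1 = a + 3 from rfl]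
    linear_combination e - h

/-! ### §2 Colourings of the blocks and the summands -/

variable {n : ℕ}

/-- Number of `true`-coloured (i.e. `Δ`-) blocks of a colouring. [this work] -/
def cT {k : ℕ} (χ : Fin k → Bool) : ℕ := ∑ m, if χ m then 1 else 0

/-- Number of `false`-coloured (i.e. `E(g⁰)`-) blocks of a colouring. [this work] -/
def cF {k : ℕ} (χ : Fin k → Bool) : ℕ := ∑ m, if χ m then 0 else 1

/-- `cT + cF` is the number of blocks. [this work] -/
theorem cT_add_cF {k : ℕ} (χ : Fin k → Bool) : cT χ + cF χ = k := by
  unfold cT cF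
  rw [← sum_add_distrib]
  have h : ∀ m : Fin k, ((if χ m then 1 else 0) + (if χ m then 0 else 1) : ℕ) = 1 := fun m => by split_ifs <;> rfl
  simp_rw [h]
  simp

/-- Counting under `Fin.cons true`. [this work] -/
theorem cT_cons_true {k : ℕ} (χ : Fin k → Bool) : cT (Fin.cons true χ : Fin (k + 1) → Bool) = cT χ + 1 := by
  unfold cT; rw [Fin.sum_univ_succ, Fin.cons_zero]; simp only [Fin.cons_succ, if_true]; omega

/-- Counting under `Fin.cons false`. [this work] -/
theorem cT_cons_false {k : ℕ} (χ : Fin k → Bool) : cT (Fin.cons false χ : Fin (k + 1) → Bool) = cT χ := by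
  unfold cT; rw [Fin.sum_univ_succ, Fin.cons_zero]; simp only [Fin.cons_succ]; simp

/-- Counting under `Fin.cons true`. [this work] -/
theorem cF_cons_true {k : ℕ} (χ : Fin k → Bool) : cF (Fin.cons true χ : Fin (k + 1) → Bool) = cF χ := by
  unfold cF; rw [Fin.sum_univ_succ, Fin.cons_zero]; simp only [Fin.cons_succ]; simp

/-- Counting under `Fin.cons false`. [this work] -/
theorem cF_cons_false {k : ℕ} (χ : Fin k → Bool) : cF (Fin.cons false χ : Fin (k + 1) → Bool) = cF χ + 1 := by
  unfold cF; rw [Fin.sum_univ_succ, Fin.cons_zero]; simp only [Fin.cons_succ, Bool.false_eq_true, if_false]; omega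

/-- Recolouring one `true` block `false` lowers `cT` by one. [this work] -/
theorem cT_update_false {k : ℕ} {χ : Fin k → Bool} {k₀ : Fin k} (h : χ k₀ = true) :
    cT (update χ k₀ false) + 1 = cT χ := by
  unfold cT
  rw [← Finset.add_sum_erase univ _ (mem_univ k₀), ← Finset.add_sum_erase univ (fun m => if χ m = true then 1 else 0) (mem_univ k₀),
    update_self, h]
  simp only [Bool.false_eq_true, if_false, if_true, zero_add]
  rw [add_comm]
  congr 1
  exact sum_congr rfl fun m hm => by rw [update_of_ne (ne_of_mem_erase hm)]

/-- … and raises `cF` by one. [this work] -/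
theorem cF_update_false {k : ℕ} {χ : Fin k → Bool} {k₀ : Fin k} (h : χ k₀ = true) :
    cF (update χ k₀ false) = cF χ + 1 := by
  unfold cF
  rw [← Finset.add_sum_erase univ _ (mem_univ k₀), ← Finset.add_sum_erase univ (fun m => if χ m = true then 0 else 1) (mem_univ k₀),
    update_self, h]
  simp only [Bool.false_eq_true, if_false, if_true, zero_add]
  rw [add_comm]
  congr 1
  exact sum_congr rfl fun m hm => by rw [update_of_ne (ne_of_mem_erase hm)]

/-- `cF` as a real sum of indicators of the `false` blocks. [this work] -/
theorem cF_cast {k : ℕ} (χ : Fin k → Bool) : (cF χ : ℝ) = ∑ m, if χ m then (0 : ℝ) else 1 := by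
  unfold cF; push_cast; exact sum_congr rfl fun m _ => by split_ifs <;> simp

/-- `cT` as a real sum of indicators of the `true` blocks. [this work] -/
theorem cT_cast {k : ℕ} (χ : Fin k → Bool) : (cT χ : ℝ) = ∑ m, if χ m then (1 : ℝ) else 0 := by
  unfold cT; push_cast; exact sum_congr rfl fun m _ => by split_ifs <;> simp

/-- The coloured block factor: `Δ_B = E(g¹|_B) − E(g⁰|_B)` on a `true` block, `E(g⁰|_B)` on a `false` block. [this work] -/
def cbf (μ : α → ℝ) (g₁ g₀ : Fin n → α → ℝ) (c : OrderedFinpartition n) (χ : Fin c.length → Bool) (m : Fin c.length) : ℝ :=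
  if χ m then blockE μ g₁ c m - blockE μ g₀ c m else blockE μ g₀ c m

/-- The summand `ψ_{cT,cF}(s) · Π_m cbf` of the pair expansion for one (set partition, colouring). [this work] -/
def pairTerm (μ : α → ℝ) (s : ℝ) (g₁ g₀ : Fin n → α → ℝ) (c : OrderedFinpartition n) (χ : Fin c.length → Bool) : ℝ :=
  pairCoeff s (cT χ) (cF χ) * ∏ m : Fin c.length, cbf μ g₁ g₀ c χ m

/-- The pair expansion `Σ_c Σ_χ pairTerm`. [this work] -/
def pairSum (μ : α → ℝ) (s : ℝ) (n : ℕ) (g₁ g₀ : Fin n → α → ℝ) : ℝ :=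
  ∑ c : OrderedFinpartition n, ∑ χ : Fin c.length → Bool, pairTerm μ s g₁ g₀ c χ

/-! ### §3 Block bookkeeping (one family) -/

/-- The block of `0` in `c.extendMiddle k₀`, expanded by the Lieb–Sahi recursion: `Σ_j E(block with slot j absorbing G_0) −
E(block)·E(G_0)`. [this work] -/
theorem blockE_extendMiddle_self_expand (μ : α → ℝ) (G : Fin (n + 1) → α → ℝ) (c : OrderedFinpartition n) (k₀ : Fin c.length) :
    blockE μ G (c.extendMiddle k₀) k₀ =
      (∑ j : Fin (c.partSize k₀), sahiE μ (c.partSize k₀)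
          (update (fun r => Fin.tail G (c.emb k₀ r)) j ((fun r : Fin (c.partSize k₀) => Fin.tail G (c.emb k₀ r)) j * G 0))) -
        blockE μ (Fin.tail G) c k₀ * ex μ (G 0) := by
  rw [blockE_extendMiddle_self, sahiE_cons_of_pos μ (c.partSize_pos k₀)]
  rfl

end

end Summit.CriticalPhenomena.PercolationContinuityZ3.Theorems.SahiTangent
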